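import Summits.Ventures.CertifiedManyBodySolver.Observables.SourcedGibbsTrialCapAFDiag
import HarnessLib

/-!
# The HF–BCS sourced cap in momentum space (XIV-c1, Néel site sums; density and spin-field sums): the ANTIFERROMAGNETIC + `d`-wave-pinned BCS quasi-free cap of the
# pinned Hubbard torus IN MOMENTUM SPACE (assembly of the one-body sums; the certifiable form)

HONEST FRAMING: zero compute; every statement is a PROVED finite-volume identity / inequality; no number is claimed (the certified
interval evaluation of the resulting finite sums is a kit job of the cell); the staggered field `M·(−1)^x` is a VARIATIONAL DEVICE in
the trial state only — the capped object is the ground-state energy of the translation-invariant, SU(2)-invariant pinned Hubbard torus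
`A_{2k}(U, μ, h)`; nothing is claimed about magnetic order; a sourced cap feeds the FLOOR edge of the Hellmann–Feynman bracket only
together with a certified source-free lower row; not a superconductivity verdict.

Cell `hubbard-obs` (D-0042 / D-0082), seat `hubbard-obs-pin-2` (`prover-hubbard-obs-pin-2-g7-0`). This file assembles files
(VIII) `groundEnergy_dWaveSourceTorus_le_HFBCS_spinField` (real-space generalized-HF cap with the spin field), (XIV-a) (diagonal
Fermi entries `= L⁻²Σ_p [c + (−1)^x s]`) and (XIV-b) (diagonal of `𝓗F`), with `Σ_x (−1)^x = 0` and `((−1)^x)² = 1` on the even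
torus, into the momentum-space cap `groundEnergy_dWaveSourceTorus_le_AFBCS_kSpace`: for every `β`, trial `μ'` and staggered
field `M`,
`E₀(A_{2k}(U,μ,h)) ≤ [Σ_p (u_↑ + u_↓) − μ'(2k)²] + (μ' − μ)[Σ_p c₀₀ + (2k)² − Σ_p d₁₁]`
`  + U·(2k)²·[n₀₀(1 − n₁₁) − s₀₀s₁₁ + n₁₀n₀₁ + s₁₀s₀₁] − M[Σ_p c_Q₀ + Σ_p d_Q₁]`
(`n_{σσ'} = (2k)⁻²Σ_p c_{σσ'}`, `s_{σσ'} = (2k)⁻²Σ_p (staggered coefficient)`; the eight coefficient functions of file (XIII-b)).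
`M = 0` is the paramagnetic k-space cap `groundEnergy_dWaveSourceTorus_le_HFBCS_kSpace`. An explicit finite sum of elementary functions
of `(ε_p, ĝ_d(p))`; interval arithmetic certifies it.

References: V. Bach, E. H. Lieb, J. P. Solovej, J. Stat. Phys. 76 (1994) 3, §2 [BachLiebSolovej1994]; J. E. Hirsch, Phys. Rev. B 31
(1985) 4403 [HirschPRB1985]; E. H. Lieb, PRL 62 (1989) 1201 [Lieb1989]; Kennedy–Lieb–Shastry, J. Stat. Phys. 53 (1988) 1019 [KLS1988JSP].
-/

noncomputable section

open Matrix Finset Literature.MathematicalPhysics.QuantumLattice Literature.Probability.LatticeModels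
open scoped ComplexConjugate

namespace Summit.Ventures.CertifiedManyBodySolver.Observables

section AFNeelSums

variable (k : ℕ) [NeZero (2 * k)]

/-! ### The Néel sign on the even torus: `ν² = 1`, `Σ_x ν_x = 0`, and the three site sums -/

omit [NeZero (2 * k)] in
/-- `((−1)^x)² = 1`. [folklore] -/
theorem neelSign_mul_self (z : TorusSite 2 (2 * k)) : (neelSign z : ℂ) * (neelSign z : ℂ) = 1 := by
  rw [← Complex.ofReal_mul, neelSign, ← pow_add, ← two_mul, pow_mul]
  norm_num

omit [NeZero (2 * k)] in
/-- The Néel index is nonzero on a torus of side `2k ≥ 3`. [cite: KLS1988JSP, p. 1021] -/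
theorem neelIndex_ne_zero (hL : 3 ≤ 2 * k) : (neelIndex (2 * k) : TorusSite 2 (2 * k)) ≠ 0 := by
  intro h0
  have h1 := congrFun h0 0
  rw [neelIndex_apply, Pi.zero_apply, ZMod.natCast_eq_zero_iff] at h1
  have hk : 0 < k := by omega
  have := Nat.le_of_dvd hk h1
  omega

/-- **`Σ_x (−1)^x = 0`** on the even torus (character orthogonality at the Néel point). [cite: KLS1988JSP, p. 1021] -/
theorem sum_neelSign_eq_zero (hL : 3 ≤ 2 * k) :
    ∑ x : FermionTorus 2 (2 * k), (neelSign x.toTorusSite : ℂ) = 0 := by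
  rw [FermionTorus.sum_eq_sum_torusSite]
  simp only [FermionTorus.toTorusSite_ofTorusSite]
  have h := sum_torusChar_right (neelIndex (2 * k) : TorusSite 2 (2 * k))
  rw [if_neg (neelIndex_ne_zero k hL)] at h
  rw [← h]
  refine Finset.sum_congr rfl fun z _ => ?_
  unfold torusChar
  exact (torusChar_neelIndex k z).symm

omit [NeZero (2 * k)] in
/-- The number of sites of the fermionic torus of side `2k`, as a complex number. [folklore] -/
theorem card_fermionTorus_two_mul : (Fintype.card (FermionTorus 2 (2 * k)) : ℂ) = ((2 * k : ℕ) : ℂ) ^ 2 := by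
  simp [FermionTorus, Fintype.card_lex]

/-- Site sum of `A + ν_x B`: `Σ_x (A + (−1)^x B) = (2k)² A`. [folklore] -/
theorem sum_uniform_add_neel (hL : 3 ≤ 2 * k) (A B : ℂ) :
    ∑ x : FermionTorus 2 (2 * k), (A + (neelSign x.toTorusSite : ℂ) * B) = ((2 * k : ℕ) : ℂ) ^ 2 * A := by
  rw [Finset.sum_add_distrib, Finset.sum_const, Finset.card_univ, nsmul_eq_mul, card_fermionTorus_two_mul,
    ← Finset.sum_mul, sum_neelSign_eq_zero k hL, zero_mul, add_zero]

/-- Site sum of `ν_x (A + ν_x B)`: `= (2k)² B`. [folklore] -/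
theorem sum_neel_mul_uniform_add_neel (hL : 3 ≤ 2 * k) (A B : ℂ) :
    ∑ x : FermionTorus 2 (2 * k), (neelSign x.toTorusSite : ℂ) * (A + (neelSign x.toTorusSite : ℂ) * B) = ((2 * k : ℕ) : ℂ) ^ 2 * B := by
  have hx : ∀ x : FermionTorus 2 (2 * k), (neelSign x.toTorusSite : ℂ) * (A + (neelSign x.toTorusSite : ℂ) * B) =
      B + (neelSign x.toTorusSite : ℂ) * A := fun x => by
    linear_combination B * neelSign_mul_self k x.toTorusSite
  rw [Finset.sum_congr rfl fun x _ => hx x, sum_uniform_add_neel k hL]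

/-- Site sum of a product: `Σ_x (A + ν_x B)(C + ν_x D) = (2k)²(AC + BD)`. [folklore] -/
theorem sum_prod_uniform_add_neel (hL : 3 ≤ 2 * k) (A B C D : ℂ) :
    ∑ x : FermionTorus 2 (2 * k), (A + (neelSign x.toTorusSite : ℂ) * B) * (C + (neelSign x.toTorusSite : ℂ) * D) =
      ((2 * k : ℕ) : ℂ) ^ 2 * (A * C + B * D) := by
  have hx : ∀ x : FermionTorus 2 (2 * k), (A + (neelSign x.toTorusSite : ℂ) * B) * (C + (neelSign x.toTorusSite : ℂ) * D) =
      (A * C + B * D) + (neelSign x.toTorusSite : ℂ) * (A * D + B * C) := fun x => by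
    linear_combination B * D * neelSign_mul_self k x.toTorusSite
  rw [Finset.sum_congr rfl fun x _ => hx x, sum_uniform_add_neel k hL]

/-! ### The four one-body sums of the generalized-Hartree–Fock cap in momentum space -/

/-- **Density sum**: `Σ_x (F(x↑,x↑) + (1 − F(x↓,x↓))) = Σ_p c₀₀ + (2k)² − Σ_p d₁₁`. [cite: BachLiebSolovej1994, §2] -/
theorem af_sum_density (hL : 3 ≤ 2 * k) (μ' h M β : ℝ) :
    ∑ x : FermionTorus 2 (2 * k), ((1 + NormedSpace.exp ((β : ℂ) • (bdgNambuMatrix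
        (fun x y => if (fermionTorusGraph 2 (2 * k)).Adj x y then -(1 : ℂ) else 0)
        (fun u v : FermionTorus 2 (2 * k) => -(h : ℂ) * ∑ i : Fin 2,
          if v = FermionTorus.ofTorusSite (u.toTorusSite + Pi.single i 1) then
            ((Real.sqrt 2 * (if i = 0 then 1 else -1) : ℝ) : ℂ) else 0) μ' +
      diagonal fun i : Orb (FermionTorus 2 (2 * k)) => ((M * neelSign ((ofLex i).1.toTorusSite) : ℝ) : ℂ))))⁻¹ (orb x 0) (orb x 0) +
        (1 - (1 + NormedSpace.exp ((β : ℂ) • (bdgNambuMatrix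
        (fun x y => if (fermionTorusGraph 2 (2 * k)).Adj x y then -(1 : ℂ) else 0)
        (fun u v : FermionTorus 2 (2 * k) => -(h : ℂ) * ∑ i : Fin 2,
          if v = FermionTorus.ofTorusSite (u.toTorusSite + Pi.single i 1) then
            ((Real.sqrt 2 * (if i = 0 then 1 else -1) : ℝ) : ℂ) else 0) μ' +
      diagonal fun i : Orb (FermionTorus 2 (2 * k)) => ((M * neelSign ((ofLex i).1.toTorusSite) : ℝ) : ℂ))))⁻¹ (orb x 1) (orb x 1))) =
      (((∑ p : TorusSite 2 (2 * k), (1 / 2 -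
          Real.tanh (β * Real.sqrt ((Real.sqrt (torusBand (2 * k) p ^ 2 + M ^ 2) + |μ'|) ^ 2 + (2 * Real.sqrt 2 * h * dWaveGap p) ^ 2) / 2) /
              (2 * Real.sqrt ((Real.sqrt (torusBand (2 * k) p ^ 2 + M ^ 2) + |μ'|) ^ 2 + (2 * Real.sqrt 2 * h * dWaveGap p) ^ 2)) *
            ((torusBand (2 * k) p - μ') / 2 - μ' / (2 * |μ'| * Real.sqrt (torusBand (2 * k) p ^ 2 + M ^ 2)) *
              (torusBand (2 * k) p ^ 2 + M ^ 2 - torusBand (2 * k) p * μ')) -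
          Real.tanh (β * Real.sqrt ((Real.sqrt (torusBand (2 * k) p ^ 2 + M ^ 2) - |μ'|) ^ 2 + (2 * Real.sqrt 2 * h * dWaveGap p) ^ 2) / 2) /
              (2 * Real.sqrt ((Real.sqrt (torusBand (2 * k) p ^ 2 + M ^ 2) - |μ'|) ^ 2 + (2 * Real.sqrt 2 * h * dWaveGap p) ^ 2)) *
            ((torusBand (2 * k) p - μ') / 2 + μ' / (2 * |μ'| * Real.sqrt (torusBand (2 * k) p ^ 2 + M ^ 2)) *
              (torusBand (2 * k) p ^ 2 + M ^ 2 - torusBand (2 * k) p * μ')))) + ((2 * k : ℕ) : ℝ) ^ 2 - (∑ p : TorusSite 2 (2 * k), (1 / 2 +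
          Real.tanh (β * Real.sqrt ((Real.sqrt (torusBand (2 * k) p ^ 2 + M ^ 2) + |μ'|) ^ 2 + (2 * Real.sqrt 2 * h * dWaveGap p) ^ 2) / 2) /
              (2 * Real.sqrt ((Real.sqrt (torusBand (2 * k) p ^ 2 + M ^ 2) + |μ'|) ^ 2 + (2 * Real.sqrt 2 * h * dWaveGap p) ^ 2)) *
            ((torusBand (2 * k) p - μ') / 2 - μ' / (2 * |μ'| * Real.sqrt (torusBand (2 * k) p ^ 2 + M ^ 2)) *
              (torusBand (2 * k) p ^ 2 + M ^ 2 - torusBand (2 * k) p * μ')) +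
          Real.tanh (β * Real.sqrt ((Real.sqrt (torusBand (2 * k) p ^ 2 + M ^ 2) - |μ'|) ^ 2 + (2 * Real.sqrt 2 * h * dWaveGap p) ^ 2) / 2) /
              (2 * Real.sqrt ((Real.sqrt (torusBand (2 * k) p ^ 2 + M ^ 2) - |μ'|) ^ 2 + (2 * Real.sqrt 2 * h * dWaveGap p) ^ 2)) *
            ((torusBand (2 * k) p - μ') / 2 + μ' / (2 * |μ'| * Real.sqrt (torusBand (2 * k) p ^ 2 + M ^ 2)) *
              (torusBand (2 * k) p ^ 2 + M ^ 2 - torusBand (2 * k) p * μ')))) : ℝ) : ℂ) := by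
  have hk0 : (k : ℂ) ≠ 0 := by exact_mod_cast (show k ≠ 0 by omega)
  have hx : ∀ x : FermionTorus 2 (2 * k), (1 + NormedSpace.exp ((β : ℂ) • (bdgNambuMatrix
        (fun x y => if (fermionTorusGraph 2 (2 * k)).Adj x y then -(1 : ℂ) else 0)
        (fun u v : FermionTorus 2 (2 * k) => -(h : ℂ) * ∑ i : Fin 2,
          if v = FermionTorus.ofTorusSite (u.toTorusSite + Pi.single i 1) then
            ((Real.sqrt 2 * (if i = 0 then 1 else -1) : ℝ) : ℂ) else 0) μ' +
      diagonal fun i : Orb (FermionTorus 2 (2 * k)) => ((M * neelSign ((ofLex i).1.toTorusSite) : ℝ) : ℂ))))⁻¹ (orb x 0) (orb x 0) +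
        (1 - (1 + NormedSpace.exp ((β : ℂ) • (bdgNambuMatrix
        (fun x y => if (fermionTorusGraph 2 (2 * k)).Adj x y then -(1 : ℂ) else 0)
        (fun u v : FermionTorus 2 (2 * k) => -(h : ℂ) * ∑ i : Fin 2,
          if v = FermionTorus.ofTorusSite (u.toTorusSite + Pi.single i 1) then
            ((Real.sqrt 2 * (if i = 0 then 1 else -1) : ℝ) : ℂ) else 0) μ' +
      diagonal fun i : Orb (FermionTorus 2 (2 * k)) => ((M * neelSign ((ofLex i).1.toTorusSite) : ℝ) : ℂ))))⁻¹ (orb x 1) (orb x 1)) =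
      ((((2 * k : ℕ) : ℂ) ^ 2)⁻¹ * (∑ p : TorusSite 2 (2 * k), (((1 / 2 -
          Real.tanh (β * Real.sqrt ((Real.sqrt (torusBand (2 * k) p ^ 2 + M ^ 2) + |μ'|) ^ 2 + (2 * Real.sqrt 2 * h * dWaveGap p) ^ 2) / 2) /
              (2 * Real.sqrt ((Real.sqrt (torusBand (2 * k) p ^ 2 + M ^ 2) + |μ'|) ^ 2 + (2 * Real.sqrt 2 * h * dWaveGap p) ^ 2)) *
            ((torusBand (2 * k) p - μ') / 2 - μ' / (2 * |μ'| * Real.sqrt (torusBand (2 * k) p ^ 2 + M ^ 2)) *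
              (torusBand (2 * k) p ^ 2 + M ^ 2 - torusBand (2 * k) p * μ')) -
          Real.tanh (β * Real.sqrt ((Real.sqrt (torusBand (2 * k) p ^ 2 + M ^ 2) - |μ'|) ^ 2 + (2 * Real.sqrt 2 * h * dWaveGap p) ^ 2) / 2) /
              (2 * Real.sqrt ((Real.sqrt (torusBand (2 * k) p ^ 2 + M ^ 2) - |μ'|) ^ 2 + (2 * Real.sqrt 2 * h * dWaveGap p) ^ 2)) *
            ((torusBand (2 * k) p - μ') / 2 + μ' / (2 * |μ'| * Real.sqrt (torusBand (2 * k) p ^ 2 + M ^ 2)) *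
              (torusBand (2 * k) p ^ 2 + M ^ 2 - torusBand (2 * k) p * μ'))) : ℝ) : ℂ)) + 1 -
          (((2 * k : ℕ) : ℂ) ^ 2)⁻¹ * (∑ p : TorusSite 2 (2 * k), (((1 / 2 +
          Real.tanh (β * Real.sqrt ((Real.sqrt (torusBand (2 * k) p ^ 2 + M ^ 2) + |μ'|) ^ 2 + (2 * Real.sqrt 2 * h * dWaveGap p) ^ 2) / 2) /
              (2 * Real.sqrt ((Real.sqrt (torusBand (2 * k) p ^ 2 + M ^ 2) + |μ'|) ^ 2 + (2 * Real.sqrt 2 * h * dWaveGap p) ^ 2)) *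
            ((torusBand (2 * k) p - μ') / 2 - μ' / (2 * |μ'| * Real.sqrt (torusBand (2 * k) p ^ 2 + M ^ 2)) *
              (torusBand (2 * k) p ^ 2 + M ^ 2 - torusBand (2 * k) p * μ')) +
          Real.tanh (β * Real.sqrt ((Real.sqrt (torusBand (2 * k) p ^ 2 + M ^ 2) - |μ'|) ^ 2 + (2 * Real.sqrt 2 * h * dWaveGap p) ^ 2) / 2) /
              (2 * Real.sqrt ((Real.sqrt (torusBand (2 * k) p ^ 2 + M ^ 2) - |μ'|) ^ 2 + (2 * Real.sqrt 2 * h * dWaveGap p) ^ 2)) *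
            ((torusBand (2 * k) p - μ') / 2 + μ' / (2 * |μ'| * Real.sqrt (torusBand (2 * k) p ^ 2 + M ^ 2)) *
              (torusBand (2 * k) p ^ 2 + M ^ 2 - torusBand (2 * k) p * μ'))) : ℝ) : ℂ))) +
        (neelSign x.toTorusSite : ℂ) * ((((2 * k : ℕ) : ℂ) ^ 2)⁻¹ * (∑ p : TorusSite 2 (2 * k), (((-M *
          (Real.tanh (β * Real.sqrt ((Real.sqrt (torusBand (2 * k) p ^ 2 + M ^ 2) + |μ'|) ^ 2 + (2 * Real.sqrt 2 * h * dWaveGap p) ^ 2) / 2) /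
              (2 * Real.sqrt ((Real.sqrt (torusBand (2 * k) p ^ 2 + M ^ 2) + |μ'|) ^ 2 + (2 * Real.sqrt 2 * h * dWaveGap p) ^ 2)) *
            (1 / 2 + μ' / (2 * |μ'| * Real.sqrt (torusBand (2 * k) p ^ 2 + M ^ 2)) * μ') +
          Real.tanh (β * Real.sqrt ((Real.sqrt (torusBand (2 * k) p ^ 2 + M ^ 2) - |μ'|) ^ 2 + (2 * Real.sqrt 2 * h * dWaveGap p) ^ 2) / 2) /
              (2 * Real.sqrt ((Real.sqrt (torusBand (2 * k) p ^ 2 + M ^ 2) - |μ'|) ^ 2 + (2 * Real.sqrt 2 * h * dWaveGap p) ^ 2)) *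
            (1 / 2 - μ' / (2 * |μ'| * Real.sqrt (torusBand (2 * k) p ^ 2 + M ^ 2)) * μ'))) : ℝ) : ℂ)) -
          (((2 * k : ℕ) : ℂ) ^ 2)⁻¹ * (∑ p : TorusSite 2 (2 * k), (((-M *
          (Real.tanh (β * Real.sqrt ((Real.sqrt (torusBand (2 * k) p ^ 2 + M ^ 2) + |μ'|) ^ 2 + (2 * Real.sqrt 2 * h * dWaveGap p) ^ 2) / 2) /
              (2 * Real.sqrt ((Real.sqrt (torusBand (2 * k) p ^ 2 + M ^ 2) + |μ'|) ^ 2 + (2 * Real.sqrt 2 * h * dWaveGap p) ^ 2)) *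
            (1 / 2 + μ' / (2 * |μ'| * Real.sqrt (torusBand (2 * k) p ^ 2 + M ^ 2)) * μ') +
          Real.tanh (β * Real.sqrt ((Real.sqrt (torusBand (2 * k) p ^ 2 + M ^ 2) - |μ'|) ^ 2 + (2 * Real.sqrt 2 * h * dWaveGap p) ^ 2) / 2) /
              (2 * Real.sqrt ((Real.sqrt (torusBand (2 * k) p ^ 2 + M ^ 2) - |μ'|) ^ 2 + (2 * Real.sqrt 2 * h * dWaveGap p) ^ 2)) *
            (1 / 2 - μ' / (2 * |μ'| * Real.sqrt (torusBand (2 * k) p ^ 2 + M ^ 2)) * μ'))) : ℝ) : ℂ))) := fun x => by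
    rw [fermi_afNambu_diag_zero_zero k hL μ' h M β x, fermi_afNambu_diag_one_one k hL μ' h M β x,
      Finset.sum_add_distrib, Finset.sum_add_distrib]
    simp only [← Finset.mul_sum]
    ring
  rw [Finset.sum_congr rfl fun x _ => hx x, sum_uniform_add_neel k hL]
  simp only [← Complex.ofReal_sum]
  generalize (∑ p : TorusSite 2 (2 * k), (1 / 2 -
          Real.tanh (β * Real.sqrt ((Real.sqrt (torusBand (2 * k) p ^ 2 + M ^ 2) + |μ'|) ^ 2 + (2 * Real.sqrt 2 * h * dWaveGap p) ^ 2) / 2) /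
              (2 * Real.sqrt ((Real.sqrt (torusBand (2 * k) p ^ 2 + M ^ 2) + |μ'|) ^ 2 + (2 * Real.sqrt 2 * h * dWaveGap p) ^ 2)) *
            ((torusBand (2 * k) p - μ') / 2 - μ' / (2 * |μ'| * Real.sqrt (torusBand (2 * k) p ^ 2 + M ^ 2)) *
              (torusBand (2 * k) p ^ 2 + M ^ 2 - torusBand (2 * k) p * μ')) -
          Real.tanh (β * Real.sqrt ((Real.sqrt (torusBand (2 * k) p ^ 2 + M ^ 2) - |μ'|) ^ 2 + (2 * Real.sqrt 2 * h * dWaveGap p) ^ 2) / 2) /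
              (2 * Real.sqrt ((Real.sqrt (torusBand (2 * k) p ^ 2 + M ^ 2) - |μ'|) ^ 2 + (2 * Real.sqrt 2 * h * dWaveGap p) ^ 2)) *
            ((torusBand (2 * k) p - μ') / 2 + μ' / (2 * |μ'| * Real.sqrt (torusBand (2 * k) p ^ 2 + M ^ 2)) *
              (torusBand (2 * k) p ^ 2 + M ^ 2 - torusBand (2 * k) p * μ')))) = S_c00
  generalize (∑ p : TorusSite 2 (2 * k), (1 / 2 +
          Real.tanh (β * Real.sqrt ((Real.sqrt (torusBand (2 * k) p ^ 2 + M ^ 2) + |μ'|) ^ 2 + (2 * Real.sqrt 2 * h * dWaveGap p) ^ 2) / 2) /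
              (2 * Real.sqrt ((Real.sqrt (torusBand (2 * k) p ^ 2 + M ^ 2) + |μ'|) ^ 2 + (2 * Real.sqrt 2 * h * dWaveGap p) ^ 2)) *
            ((torusBand (2 * k) p - μ') / 2 - μ' / (2 * |μ'| * Real.sqrt (torusBand (2 * k) p ^ 2 + M ^ 2)) *
              (torusBand (2 * k) p ^ 2 + M ^ 2 - torusBand (2 * k) p * μ')) +
          Real.tanh (β * Real.sqrt ((Real.sqrt (torusBand (2 * k) p ^ 2 + M ^ 2) - |μ'|) ^ 2 + (2 * Real.sqrt 2 * h * dWaveGap p) ^ 2) / 2) /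
              (2 * Real.sqrt ((Real.sqrt (torusBand (2 * k) p ^ 2 + M ^ 2) - |μ'|) ^ 2 + (2 * Real.sqrt 2 * h * dWaveGap p) ^ 2)) *
            ((torusBand (2 * k) p - μ') / 2 + μ' / (2 * |μ'| * Real.sqrt (torusBand (2 * k) p ^ 2 + M ^ 2)) *
              (torusBand (2 * k) p ^ 2 + M ^ 2 - torusBand (2 * k) p * μ')))) = S_d11
  push_cast
  field_simp

/-- **Spin-field sum**: `Σ_x (−M(−1)^x)(F(x↑,x↑) − 1 + F(x↓,x↓)) = −M(Σ_p c_Q₀ + Σ_p d_Q₁)`. [cite: BachLiebSolovej1994, §2] -/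
theorem af_sum_spinField (hL : 3 ≤ 2 * k) (μ' h M β : ℝ) :
    ∑ x : FermionTorus 2 (2 * k), ((-(M * neelSign x.toTorusSite) : ℝ) : ℂ) *
        ((1 + NormedSpace.exp ((β : ℂ) • (bdgNambuMatrix
        (fun x y => if (fermionTorusGraph 2 (2 * k)).Adj x y then -(1 : ℂ) else 0)
        (fun u v : FermionTorus 2 (2 * k) => -(h : ℂ) * ∑ i : Fin 2,
          if v = FermionTorus.ofTorusSite (u.toTorusSite + Pi.single i 1) then
            ((Real.sqrt 2 * (if i = 0 then 1 else -1) : ℝ) : ℂ) else 0) μ' +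
      diagonal fun i : Orb (FermionTorus 2 (2 * k)) => ((M * neelSign ((ofLex i).1.toTorusSite) : ℝ) : ℂ))))⁻¹ (orb x 0) (orb x 0) - 1 +
          (1 + NormedSpace.exp ((β : ℂ) • (bdgNambuMatrix
        (fun x y => if (fermionTorusGraph 2 (2 * k)).Adj x y then -(1 : ℂ) else 0)
        (fun u v : FermionTorus 2 (2 * k) => -(h : ℂ) * ∑ i : Fin 2,
          if v = FermionTorus.ofTorusSite (u.toTorusSite + Pi.single i 1) then
            ((Real.sqrt 2 * (if i = 0 then 1 else -1) : ℝ) : ℂ) else 0) μ' +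
      diagonal fun i : Orb (FermionTorus 2 (2 * k)) => ((M * neelSign ((ofLex i).1.toTorusSite) : ℝ) : ℂ))))⁻¹ (orb x 1) (orb x 1)) =
      ((-M * ((∑ p : TorusSite 2 (2 * k), (-M *
          (Real.tanh (β * Real.sqrt ((Real.sqrt (torusBand (2 * k) p ^ 2 + M ^ 2) + |μ'|) ^ 2 + (2 * Real.sqrt 2 * h * dWaveGap p) ^ 2) / 2) /
              (2 * Real.sqrt ((Real.sqrt (torusBand (2 * k) p ^ 2 + M ^ 2) + |μ'|) ^ 2 + (2 * Real.sqrt 2 * h * dWaveGap p) ^ 2)) *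
            (1 / 2 + μ' / (2 * |μ'| * Real.sqrt (torusBand (2 * k) p ^ 2 + M ^ 2)) * μ') +
          Real.tanh (β * Real.sqrt ((Real.sqrt (torusBand (2 * k) p ^ 2 + M ^ 2) - |μ'|) ^ 2 + (2 * Real.sqrt 2 * h * dWaveGap p) ^ 2) / 2) /
              (2 * Real.sqrt ((Real.sqrt (torusBand (2 * k) p ^ 2 + M ^ 2) - |μ'|) ^ 2 + (2 * Real.sqrt 2 * h * dWaveGap p) ^ 2)) *
            (1 / 2 - μ' / (2 * |μ'| * Real.sqrt (torusBand (2 * k) p ^ 2 + M ^ 2)) * μ')))) + (∑ p : TorusSite 2 (2 * k), (-M *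
          (Real.tanh (β * Real.sqrt ((Real.sqrt (torusBand (2 * k) p ^ 2 + M ^ 2) + |μ'|) ^ 2 + (2 * Real.sqrt 2 * h * dWaveGap p) ^ 2) / 2) /
              (2 * Real.sqrt ((Real.sqrt (torusBand (2 * k) p ^ 2 + M ^ 2) + |μ'|) ^ 2 + (2 * Real.sqrt 2 * h * dWaveGap p) ^ 2)) *
            (1 / 2 + μ' / (2 * |μ'| * Real.sqrt (torusBand (2 * k) p ^ 2 + M ^ 2)) * μ') +
          Real.tanh (β * Real.sqrt ((Real.sqrt (torusBand (2 * k) p ^ 2 + M ^ 2) - |μ'|) ^ 2 + (2 * Real.sqrt 2 * h * dWaveGap p) ^ 2) / 2) /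
              (2 * Real.sqrt ((Real.sqrt (torusBand (2 * k) p ^ 2 + M ^ 2) - |μ'|) ^ 2 + (2 * Real.sqrt 2 * h * dWaveGap p) ^ 2)) *
            (1 / 2 - μ' / (2 * |μ'| * Real.sqrt (torusBand (2 * k) p ^ 2 + M ^ 2)) * μ'))))) : ℝ) : ℂ) := by
  have hk0 : (k : ℂ) ≠ 0 := by exact_mod_cast (show k ≠ 0 by omega)
  have hx : ∀ x : FermionTorus 2 (2 * k), ((-(M * neelSign x.toTorusSite) : ℝ) : ℂ) *
        ((1 + NormedSpace.exp ((β : ℂ) • (bdgNambuMatrix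
        (fun x y => if (fermionTorusGraph 2 (2 * k)).Adj x y then -(1 : ℂ) else 0)
        (fun u v : FermionTorus 2 (2 * k) => -(h : ℂ) * ∑ i : Fin 2,
          if v = FermionTorus.ofTorusSite (u.toTorusSite + Pi.single i 1) then
            ((Real.sqrt 2 * (if i = 0 then 1 else -1) : ℝ) : ℂ) else 0) μ' +
      diagonal fun i : Orb (FermionTorus 2 (2 * k)) => ((M * neelSign ((ofLex i).1.toTorusSite) : ℝ) : ℂ))))⁻¹ (orb x 0) (orb x 0) - 1 +
          (1 + NormedSpace.exp ((β : ℂ) • (bdgNambuMatrix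
        (fun x y => if (fermionTorusGraph 2 (2 * k)).Adj x y then -(1 : ℂ) else 0)
        (fun u v : FermionTorus 2 (2 * k) => -(h : ℂ) * ∑ i : Fin 2,
          if v = FermionTorus.ofTorusSite (u.toTorusSite + Pi.single i 1) then
            ((Real.sqrt 2 * (if i = 0 then 1 else -1) : ℝ) : ℂ) else 0) μ' +
      diagonal fun i : Orb (FermionTorus 2 (2 * k)) => ((M * neelSign ((ofLex i).1.toTorusSite) : ℝ) : ℂ))))⁻¹ (orb x 1) (orb x 1)) =
      -(M : ℂ) * ((neelSign x.toTorusSite : ℂ) *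
        (((((2 * k : ℕ) : ℂ) ^ 2)⁻¹ * (∑ p : TorusSite 2 (2 * k), (((1 / 2 -
          Real.tanh (β * Real.sqrt ((Real.sqrt (torusBand (2 * k) p ^ 2 + M ^ 2) + |μ'|) ^ 2 + (2 * Real.sqrt 2 * h * dWaveGap p) ^ 2) / 2) /
              (2 * Real.sqrt ((Real.sqrt (torusBand (2 * k) p ^ 2 + M ^ 2) + |μ'|) ^ 2 + (2 * Real.sqrt 2 * h * dWaveGap p) ^ 2)) *
            ((torusBand (2 * k) p - μ') / 2 - μ' / (2 * |μ'| * Real.sqrt (torusBand (2 * k) p ^ 2 + M ^ 2)) *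
              (torusBand (2 * k) p ^ 2 + M ^ 2 - torusBand (2 * k) p * μ')) -
          Real.tanh (β * Real.sqrt ((Real.sqrt (torusBand (2 * k) p ^ 2 + M ^ 2) - |μ'|) ^ 2 + (2 * Real.sqrt 2 * h * dWaveGap p) ^ 2) / 2) /
              (2 * Real.sqrt ((Real.sqrt (torusBand (2 * k) p ^ 2 + M ^ 2) - |μ'|) ^ 2 + (2 * Real.sqrt 2 * h * dWaveGap p) ^ 2)) *
            ((torusBand (2 * k) p - μ') / 2 + μ' / (2 * |μ'| * Real.sqrt (torusBand (2 * k) p ^ 2 + M ^ 2)) *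
              (torusBand (2 * k) p ^ 2 + M ^ 2 - torusBand (2 * k) p * μ'))) : ℝ) : ℂ)) - 1 +
            (((2 * k : ℕ) : ℂ) ^ 2)⁻¹ * (∑ p : TorusSite 2 (2 * k), (((1 / 2 +
          Real.tanh (β * Real.sqrt ((Real.sqrt (torusBand (2 * k) p ^ 2 + M ^ 2) + |μ'|) ^ 2 + (2 * Real.sqrt 2 * h * dWaveGap p) ^ 2) / 2) /
              (2 * Real.sqrt ((Real.sqrt (torusBand (2 * k) p ^ 2 + M ^ 2) + |μ'|) ^ 2 + (2 * Real.sqrt 2 * h * dWaveGap p) ^ 2)) *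
            ((torusBand (2 * k) p - μ') / 2 - μ' / (2 * |μ'| * Real.sqrt (torusBand (2 * k) p ^ 2 + M ^ 2)) *
              (torusBand (2 * k) p ^ 2 + M ^ 2 - torusBand (2 * k) p * μ')) +
          Real.tanh (β * Real.sqrt ((Real.sqrt (torusBand (2 * k) p ^ 2 + M ^ 2) - |μ'|) ^ 2 + (2 * Real.sqrt 2 * h * dWaveGap p) ^ 2) / 2) /
              (2 * Real.sqrt ((Real.sqrt (torusBand (2 * k) p ^ 2 + M ^ 2) - |μ'|) ^ 2 + (2 * Real.sqrt 2 * h * dWaveGap p) ^ 2)) *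
            ((torusBand (2 * k) p - μ') / 2 + μ' / (2 * |μ'| * Real.sqrt (torusBand (2 * k) p ^ 2 + M ^ 2)) *
              (torusBand (2 * k) p ^ 2 + M ^ 2 - torusBand (2 * k) p * μ'))) : ℝ) : ℂ))) +
          (neelSign x.toTorusSite : ℂ) * ((((2 * k : ℕ) : ℂ) ^ 2)⁻¹ * (∑ p : TorusSite 2 (2 * k), (((-M *
          (Real.tanh (β * Real.sqrt ((Real.sqrt (torusBand (2 * k) p ^ 2 + M ^ 2) + |μ'|) ^ 2 + (2 * Real.sqrt 2 * h * dWaveGap p) ^ 2) / 2) /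
              (2 * Real.sqrt ((Real.sqrt (torusBand (2 * k) p ^ 2 + M ^ 2) + |μ'|) ^ 2 + (2 * Real.sqrt 2 * h * dWaveGap p) ^ 2)) *
            (1 / 2 + μ' / (2 * |μ'| * Real.sqrt (torusBand (2 * k) p ^ 2 + M ^ 2)) * μ') +
          Real.tanh (β * Real.sqrt ((Real.sqrt (torusBand (2 * k) p ^ 2 + M ^ 2) - |μ'|) ^ 2 + (2 * Real.sqrt 2 * h * dWaveGap p) ^ 2) / 2) /
              (2 * Real.sqrt ((Real.sqrt (torusBand (2 * k) p ^ 2 + M ^ 2) - |μ'|) ^ 2 + (2 * Real.sqrt 2 * h * dWaveGap p) ^ 2)) *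
            (1 / 2 - μ' / (2 * |μ'| * Real.sqrt (torusBand (2 * k) p ^ 2 + M ^ 2)) * μ'))) : ℝ) : ℂ)) +
            (((2 * k : ℕ) : ℂ) ^ 2)⁻¹ * (∑ p : TorusSite 2 (2 * k), (((-M *
          (Real.tanh (β * Real.sqrt ((Real.sqrt (torusBand (2 * k) p ^ 2 + M ^ 2) + |μ'|) ^ 2 + (2 * Real.sqrt 2 * h * dWaveGap p) ^ 2) / 2) /
              (2 * Real.sqrt ((Real.sqrt (torusBand (2 * k) p ^ 2 + M ^ 2) + |μ'|) ^ 2 + (2 * Real.sqrt 2 * h * dWaveGap p) ^ 2)) *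
            (1 / 2 + μ' / (2 * |μ'| * Real.sqrt (torusBand (2 * k) p ^ 2 + M ^ 2)) * μ') +
          Real.tanh (β * Real.sqrt ((Real.sqrt (torusBand (2 * k) p ^ 2 + M ^ 2) - |μ'|) ^ 2 + (2 * Real.sqrt 2 * h * dWaveGap p) ^ 2) / 2) /
              (2 * Real.sqrt ((Real.sqrt (torusBand (2 * k) p ^ 2 + M ^ 2) - |μ'|) ^ 2 + (2 * Real.sqrt 2 * h * dWaveGap p) ^ 2)) *
            (1 / 2 - μ' / (2 * |μ'| * Real.sqrt (torusBand (2 * k) p ^ 2 + M ^ 2)) * μ'))) : ℝ) : ℂ))))) := fun x => by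
    rw [fermi_afNambu_diag_zero_zero k hL μ' h M β x, fermi_afNambu_diag_one_one k hL μ' h M β x,
      Finset.sum_add_distrib, Finset.sum_add_distrib]
    simp only [← Finset.mul_sum]
    push_cast
    ring
  rw [Finset.sum_congr rfl fun x _ => hx x, ← Finset.mul_sum, sum_neel_mul_uniform_add_neel k hL]
  simp only [← Complex.ofReal_sum]
  generalize (∑ p : TorusSite 2 (2 * k), (-M *
          (Real.tanh (β * Real.sqrt ((Real.sqrt (torusBand (2 * k) p ^ 2 + M ^ 2) + |μ'|) ^ 2 + (2 * Real.sqrt 2 * h * dWaveGap p) ^ 2) / 2) /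
              (2 * Real.sqrt ((Real.sqrt (torusBand (2 * k) p ^ 2 + M ^ 2) + |μ'|) ^ 2 + (2 * Real.sqrt 2 * h * dWaveGap p) ^ 2)) *
            (1 / 2 + μ' / (2 * |μ'| * Real.sqrt (torusBand (2 * k) p ^ 2 + M ^ 2)) * μ') +
          Real.tanh (β * Real.sqrt ((Real.sqrt (torusBand (2 * k) p ^ 2 + M ^ 2) - |μ'|) ^ 2 + (2 * Real.sqrt 2 * h * dWaveGap p) ^ 2) / 2) /
              (2 * Real.sqrt ((Real.sqrt (torusBand (2 * k) p ^ 2 + M ^ 2) - |μ'|) ^ 2 + (2 * Real.sqrt 2 * h * dWaveGap p) ^ 2)) *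
            (1 / 2 - μ' / (2 * |μ'| * Real.sqrt (torusBand (2 * k) p ^ 2 + M ^ 2)) * μ')))) = S_cQ0
  generalize (∑ p : TorusSite 2 (2 * k), (-M *
          (Real.tanh (β * Real.sqrt ((Real.sqrt (torusBand (2 * k) p ^ 2 + M ^ 2) + |μ'|) ^ 2 + (2 * Real.sqrt 2 * h * dWaveGap p) ^ 2) / 2) /
              (2 * Real.sqrt ((Real.sqrt (torusBand (2 * k) p ^ 2 + M ^ 2) + |μ'|) ^ 2 + (2 * Real.sqrt 2 * h * dWaveGap p) ^ 2)) *
            (1 / 2 + μ' / (2 * |μ'| * Real.sqrt (torusBand (2 * k) p ^ 2 + M ^ 2)) * μ') +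
          Real.tanh (β * Real.sqrt ((Real.sqrt (torusBand (2 * k) p ^ 2 + M ^ 2) - |μ'|) ^ 2 + (2 * Real.sqrt 2 * h * dWaveGap p) ^ 2) / 2) /
              (2 * Real.sqrt ((Real.sqrt (torusBand (2 * k) p ^ 2 + M ^ 2) - |μ'|) ^ 2 + (2 * Real.sqrt 2 * h * dWaveGap p) ^ 2)) *
            (1 / 2 - μ' / (2 * |μ'| * Real.sqrt (torusBand (2 * k) p ^ 2 + M ^ 2)) * μ')))) = S_dQ1
  push_cast
  field_simp

end AFNeelSums

end Summit.Ventures.CertifiedManyBodySolver.Observables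

end
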